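/-
Copyright: the b2b-balaban T⁴-continuum CRUX team, row NE7b OWNER lineage `t4-ne7b-p1` (gen 139). Project licence.
-/
import Summits.QuantumFields.BalabanUV.T4Continuum.Spine.NE7b.SupTiltedCovarianceKernelLetter
import Summits.QuantumFields.BalabanUV.T4Continuum.Spine.NE7b.SupBlockHessianKernelSplit
import Summits.QuantumFields.BalabanUV.T4Continuum.Spine.NE7b.SupTiltedTransfer

/-!
# THE OUTPUT HESSIAN'S KERNEL LETTER, CLOSED (SCOPING (d10)(2) ⟹ (439)): the tilted covariance kernel of the block step,
#   `C_{xy}(ψ) = Z⁻¹∫e^{−U(ω+ψ)}U′[e_x]U′[e_y]dN(0,M⁻¹) − Z⁻²(∫e^{−U}U′[e_x])(∫e^{−U}U′[e_y])`,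
# IS the covariance of the gradient components under the Gibbs law `e^{−½z·Mz − U(toLp z+ψ)}dz∕∫` of (449) ((421)'s transfer
# `∫gaussWeight·h = 𝒩_M∫h∘ofLp dN(0,M⁻¹)`), so (449)'s Dobrushin letter bounds its row sums:
#   `Σ_y |C_{xy}(ψ)| ≤ κR·κC·(1−γ)⁻¹(1−γ′)⁻¹∕cmin`   uniformly in `ψ` and `|ι|`,
# and with (439) `hessian_kernel_rowsum_split` THE OUTPUT HESSIAN KERNEL LETTER of the block class follows:
#   `Σ_y |HessW(ψ)[e_x,e_y]| ≤ κr + κR·κC·(1−γ)⁻¹(1−γ′)⁻¹∕cmin`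
# under (439)'s regulator hypotheses, the first-order kernel letters of the input and the row-diagonal dominance of the precision `M = Γ⁻¹`
# over the input's kernel (row NE7b, node U5c; (421), (439), (449) BY NAME; [folklore])

Cell `pub-balaban`, sub-cell `t4`, spine estimate NE7b (`T4WeightBudget.RelWeightBound`; the cell's OWN estimate — NOT PRINTED in
[Bałaban 1983–89], NOT PROVED).  Crux-route work under `Spine/NE7b/` by the row OWNER (`t4-ne7b-p1` gen 139, file (450)) under FREEZE
(0)'s crux-prover clause; NOTHING of Bałaban's is named as a Lean object, valued or asserted; no `T4Continuum/Support` leaf typed; no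
`def`, no notation; zero `sorry`.  Imports (BY NAME): the OWNER's (449) `…SupTiltedCovarianceKernelLetter` (`tilted_cov_kernel_rowsum_le`),
(447) (`integral_tilted_eq`), (439) `…SupBlockHessianKernelSplit` (`hessian_kernel_rowsum_split`), (421) `…SupTiltedTransfer`
(`integral_gaussWeight_mul`), the Literature's `B2Eq228Conditioning` (`gaussProb`, `gaussProb_eq_map_multivariateGaussian`, `gaussNorm_pos`,
`gaussWeight_pos`, `measurable_gaussWeight_real`), `SupGaussianRegulator.transpose_eq_of_posSemidef`.

WHAT IS PROVED ([folklore]; `M ≻ 0` the precision, `U ∈ C¹`, background `ψ`):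
* §1 the bridge: `lebesgue_integral_eq_gauss` (`∫h·e^{−V}dz = 𝒩_M∫e^{−U(ω+ψ)}h(ofLp ω)dN(0,M⁻¹)`), `tilted_integral_eq_gauss` (`∫g dν_V =
  ∫e^{−U}g∘ofLp dN ∕ ∫e^{−U}dN`), `integrable_lebesgue_of_gauss` (Gaussian-side integrability of `e^{−U}k` ⟹ Lebesgue-side of `k∘toLp·e^{−V}`).
* §2 **`gauss_cov_kernel_rowsum_le`** (`Σ_y|C_{xy}(ψ)| ≤ κR·κC·(1−γ)⁻¹(1−γ′)⁻¹∕cmin`, in (439)'s format with `Γ = M⁻¹`).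
* §3 THE END **`block_hessian_kernel_rowsum_le`** ((439) ⊕ §2: `Σ_y|HessW(ψ)[e_x,e_y]| ≤ κr + κR·κC·(1−γ)⁻¹(1−γ′)⁻¹∕cmin`).

HONEST (what this is NOT).  The first-order kernel letters (`lam, κd, H`) and the second-moment letter `e^{−U(ω+ψ)}ω_w² ∈ L¹(N)` are
hypotheses (for (427)'s class they follow from (433)∕(438) and the regulator (410)∕(423) — not re-derived here); the precision's row-diagonal
dominance is a CONDITION ON THE NEXT COVARIANCE in kernel letters.  The re-run of (427) in kernel letters ((d10)(3)) and the multi-block step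
((d10)(4)) are the successor's.  Scalar skeleton ((A3), NC-NE7b-α UNRULED); nothing of Bałaban's asserted.  BY-NAME EFFECT ON THE WALL: NONE.
NE7b NOT PRINTED ∕ NOT PROVED; spine PROVED 0∕9; rung (B)+1 — the programme's measures remain FINITE-torus statements; NOT the mass gap,
NOT Clay.  HONEST DEPENDENCY: continuum YM on T⁴ ⇐ BetaPertH ∧ nine spine estimates (0∕9 proved); BetaPertH ⇐ (D1) ∧ (D4) ∧ CAP+tail;
G-an2-4 gates asym, D1 and NE2∕3∕4.
-/

set_option autoImplicit false
set_option maxSynthPendingDepth 2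

noncomputable section

namespace Summit.QuantumFields.BalabanUV.T4Continuum.NE7b.SupBlockCovarianceKernelLetter

open MeasureTheory ProbabilityTheory Real Set Function Finset Matrix
open scoped BigOperators ENNReal
open Literature.MathematicalPhysics.QuantumFieldTheory.Balaban1983to89
open B13GaugeDevices (gaussWeight gaussNorm)
open B2Eq228Conditioning (gaussProb gaussProb_eq_map_multivariateGaussian gaussNorm_pos gaussWeight_pos measurable_gaussWeight_real)
open SupGaussianRegulator (transpose_eq_of_posSemidef)
open SupTiltedTransfer (integral_gaussWeight_mul)
open SupDobrushinCovarianceGibbs (integral_tilted_eq)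
open SupTiltedCovarianceKernelLetter (tilted_cov_kernel_rowsum_le)
open SupBlockHessianKernelSplit (hessian_kernel_rowsum_split)

variable {ι : Type} [Fintype ι] [DecidableEq ι]

variable {M : Matrix ι ι ℝ} {γop : ℝ} {U : EuclideanSpace ℝ ι → ℝ} {U' : EuclideanSpace ℝ ι → EuclideanSpace ℝ ι →L[ℝ] ℝ}
  {U'' : EuclideanSpace ℝ ι → EuclideanSpace ℝ ι →L[ℝ] EuclideanSpace ℝ ι →L[ℝ] ℝ} {κ₀ κ₁ κ₂ κr a τ δ θ : ℝ}
  {ψ : EuclideanSpace ℝ ι} {lam κd mM γ γ' cmin κR κC : ℝ} {H : ι → ι → ℝ}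

/-! ## §1. The bridge between `e^{−V}dz` and `e^{−U(ω+ψ)}dN(0,M⁻¹)(ω)` -/

/-- **`∫h·e^{−V}dz = 𝒩_M·∫e^{−U(ω+ψ)}h(ofLp ω)dN(0,M⁻¹)`** (`V(z) = ½z·Mz + U(toLp z + ψ)`, `M ≻ 0`). [folklore] -/
theorem lebesgue_integral_eq_gauss (hM : M.PosDef) (ψ : EuclideanSpace ℝ ι) (h : (ι → ℝ) → ℝ) :
    ∫ z, h z * exp (-(1 / 2 * (z ⬝ᵥ (M *ᵥ z)) + U (WithLp.toLp 2 z + ψ))) =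
      gaussNorm M * ∫ ω, exp (-U (ω + ψ)) * h (WithLp.ofLp ω) ∂(multivariateGaussian 0 M⁻¹) := by
  have e : ∀ z : ι → ℝ, h z * exp (-(1 / 2 * (z ⬝ᵥ (M *ᵥ z)) + U (WithLp.toLp 2 z + ψ))) =
      gaussWeight M z * (exp (-U (WithLp.toLp 2 z + ψ)) * h z) := fun z => by
    rw [neg_add, exp_add, gaussWeight]; ring
  simp_rw [e]
  rw [integral_gaussWeight_mul hM]

/-- **`∫g dν_V = ∫e^{−U(ω+ψ)}g(ofLp ω)dN(0,M⁻¹) ∕ ∫e^{−U(ω+ψ)}dN(0,M⁻¹)`** for the Gibbs law `ν_V = volume.tilted (−V)`. [folklore] -/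
theorem tilted_integral_eq_gauss (hM : M.PosDef) (ψ : EuclideanSpace ℝ ι) (g : (ι → ℝ) → ℝ) :
    ∫ z, g z ∂((volume : Measure (ι → ℝ)).tilted fun z => -(1 / 2 * (z ⬝ᵥ (M *ᵥ z)) + U (WithLp.toLp 2 z + ψ))) =
      (∫ ω, exp (-U (ω + ψ)) * g (WithLp.ofLp ω) ∂(multivariateGaussian 0 M⁻¹)) / ∫ ω, exp (-U (ω + ψ)) ∂(multivariateGaussian 0 M⁻¹) := by
  have hN := gaussNorm_pos hM
  have h1 := lebesgue_integral_eq_gauss (U := U) hM ψ (fun _ => (1 : ℝ))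
  simp only [one_mul, mul_one] at h1
  rw [integral_tilted_eq, lebesgue_integral_eq_gauss hM ψ g, h1, mul_div_mul_left _ _ hN.ne']

/-- **Integrability transfers**: `e^{−U(ω+ψ)}k(ω) ∈ L¹(N(0,M⁻¹))` ⟹ `k(toLp z)·e^{−V(z)} ∈ L¹(dz)`. [folklore] -/
theorem integrable_lebesgue_of_gauss (hM : M.PosDef) (ψ : EuclideanSpace ℝ ι) {k : EuclideanSpace ℝ ι → ℝ}
    (hk : Integrable (fun ω : EuclideanSpace ℝ ι => exp (-U (ω + ψ)) * k ω) (multivariateGaussian 0 M⁻¹)) :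
    Integrable (fun z : ι → ℝ => k (WithLp.toLp 2 z) * exp (-(1 / 2 * (z ⬝ᵥ (M *ᵥ z)) + U (WithLp.toLp 2 z + ψ)))) := by
  have hN := gaussNorm_pos hM
  have hmeas : Measurable fun z : ι → ℝ => ENNReal.ofReal (gaussWeight M z) := (measurable_gaussWeight_real M).ennreal_ofReal
  have hgp : Integrable (fun z : ι → ℝ => exp (-U (WithLp.toLp 2 z + ψ)) * k (WithLp.toLp 2 z)) (gaussProb M) := by
    rw [gaussProb_eq_map_multivariateGaussian hM, integrable_map_equiv]
    refine hk.congr (ae_of_all _ fun ω => ?_)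
    simp only [Function.comp_apply, MeasurableEquiv.coe_toLp_symm, WithLp.toLp_ofLp]
  rw [gaussProb, integrable_smul_measure (by rw [ne_eq, ENNReal.ofReal_eq_zero, not_le]; exact inv_pos.2 hN) ENNReal.ofReal_ne_top,
    integrable_withDensity_iff_integrable_smul' hmeas (ae_of_all _ fun _ => ENNReal.ofReal_lt_top)] at hgp
  refine hgp.congr (ae_of_all _ fun z => ?_)
  simp only [ENNReal.toReal_ofReal (gaussWeight_pos M z).le, smul_eq_mul]
  rw [neg_add, exp_add, gaussWeight]
  ring

/-! ## §2. The covariance kernel letter in the road's `dN(0,M⁻¹)` format -/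

/-- **`Σ_y |C_{xy}(ψ)| ≤ κR·κC·(1−γ)⁻¹(1−γ′)⁻¹∕cmin`** for the tilted covariance kernel of (439) (`Γ = M⁻¹`, `M ≻ 0`), under the
first-order kernel letters of the input, the precision letters and the row-diagonal dominance, and the moment letters — (449) transferred.
[folklore: Dobrushin 1970, Föllmer 1982] -/
theorem gauss_cov_kernel_rowsum_le (hM : M.PosDef) (hUd : ∀ φ : EuclideanSpace ℝ ι, HasFDerivAt U (U' φ) φ)
    (hUfloor : ∀ (x : ι) (φ : EuclideanSpace ℝ ι) (r : ℝ),
      -lam * r ^ 2 ≤ (U' (φ + r • EuclideanSpace.single x (1 : ℝ)) (EuclideanSpace.single x (1 : ℝ)) - U' φ (EuclideanSpace.single x (1 : ℝ))) * r)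
    (hUceil : ∀ (x : ι) (φ : EuclideanSpace ℝ ι) (r : ℝ),
      |U' (φ + r • EuclideanSpace.single x (1 : ℝ)) (EuclideanSpace.single x (1 : ℝ)) - U' φ (EuclideanSpace.single x (1 : ℝ))| ≤ κd * |r|)
    (hUcross : ∀ (x w : ι) (φ : EuclideanSpace ℝ ι) (r : ℝ),
      |U' (φ + r • EuclideanSpace.single w (1 : ℝ)) (EuclideanSpace.single x (1 : ℝ)) - U' φ (EuclideanSpace.single x (1 : ℝ))| ≤ H x w * |r|)
    (hH : ∀ x w, 0 ≤ H x w) (hκd : 0 ≤ κd) (hMdiag : ∀ x, |M x x| ≤ mM) (hcmin : 0 < cmin) (hcm : ∀ x, cmin ≤ M x x - lam)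
    (hrow : ∀ x, ∑ w, (if w = x then 0 else |M x w| + H x w) / (M x x - lam) ≤ γ) (hγ0 : 0 ≤ γ) (hγ1 : γ < 1)
    (hcol : ∀ w, ∑ x, (if w = x then 0 else |M x w| + H x w) / (M x x - lam) ≤ γ') (hγ'1 : γ' < 1)
    (hκR : ∀ x, ∑ w, (if w = x then κd else H x w) ≤ κR) (hκC : ∀ w, ∑ x, (if w = x then κd else H x w) ≤ κC)
    (hI0 : Integrable (fun ω : EuclideanSpace ℝ ι => exp (-U (ω + ψ))) (multivariateGaussian 0 M⁻¹))
    (hI2 : ∀ w, Integrable (fun ω : EuclideanSpace ℝ ι => exp (-U (ω + ψ)) * ω w ^ 2) (multivariateGaussian 0 M⁻¹)) (x : ι) :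
    ∑ y, |((∫ ω : EuclideanSpace ℝ ι, exp (-U (ω + ψ)) ∂(multivariateGaussian 0 M⁻¹))⁻¹ * (∫ ω : EuclideanSpace ℝ ι, exp (-U (ω + ψ)) * (U' (ω + ψ)
          (EuclideanSpace.single x (1 : ℝ)) * U' (ω + ψ) (EuclideanSpace.single y (1 : ℝ))) ∂(multivariateGaussian 0 M⁻¹)) - ((∫ ω : EuclideanSpace ℝ ι, exp (-U (ω + ψ))
          ∂(multivariateGaussian 0 M⁻¹)) ^ 2)⁻¹ * ((∫ ω : EuclideanSpace ℝ ι, exp (-U (ω + ψ)) * U' (ω + ψ) (EuclideanSpace.single x (1 : ℝ)) ∂(multivariateGaussian 0 M⁻¹)) *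
          (∫ ω : EuclideanSpace ℝ ι, exp (-U (ω + ψ)) * U' (ω + ψ) (EuclideanSpace.single y (1 : ℝ)) ∂(multivariateGaussian 0 M⁻¹))))| ≤
      κR * κC * (1 - γ)⁻¹ * (1 - γ')⁻¹ / cmin := by
  have hMsym : M.IsSymm := transpose_eq_of_posSemidef hM.posSemidef
  -- the moment letters in Lebesgue form
  have hV0 : Integrable (fun z : ι → ℝ => exp (-(1 / 2 * (z ⬝ᵥ (M *ᵥ z)) + U (WithLp.toLp 2 z + ψ)))) := by
    have h := integrable_lebesgue_of_gauss hM ψ (k := fun _ => (1 : ℝ)) (by simpa only [mul_one] using hI0)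
    simpa only [one_mul] using h
  have hV2 : ∀ w, Integrable (fun z : ι → ℝ => z w ^ 2 * exp (-(1 / 2 * (z ⬝ᵥ (M *ᵥ z)) + U (WithLp.toLp 2 z + ψ)))) := fun w => by
    have h := integrable_lebesgue_of_gauss hM ψ (k := fun ω : EuclideanSpace ℝ ι => ω w ^ 2) (hI2 w)
    simpa only [PiLp.toLp_apply] using h
  -- (449) for the written-out sampler
  have h449 := tilted_cov_kernel_rowsum_le hMsym hUd
    (P := fun x F ω => (∫ s, F (update ω x s) * exp (-(1 / 2 * (update ω x s ⬝ᵥ (M *ᵥ update ω x s)) + U (WithLp.toLp 2 (update ω x s) + ψ)))) /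
      ∫ s, exp (-(1 / 2 * (update ω x s ⬝ᵥ (M *ᵥ update ω x s)) + U (WithLp.toLp 2 (update ω x s) + ψ))))
    (fun _ _ _ => rfl) hUfloor hUceil hUcross hH hκd hMdiag hcmin hcm hrow hγ0 hγ1 hcol hγ'1 hκR hκC hV0 hV2 x
  refine le_trans (le_of_eq (Finset.sum_congr rfl fun y _ => ?_)) h449
  rw [tilted_integral_eq_gauss hM ψ, tilted_integral_eq_gauss hM ψ, tilted_integral_eq_gauss hM ψ]
  simp only [WithLp.toLp_ofLp]
  congr 1
  ring

/-! ## §3. The output Hessian's kernel letter -/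

/-- **THE OUTPUT HESSIAN KERNEL LETTER OF THE BLOCK CLASS** ((439) ⊕ §2): under (439)'s regulator hypotheses (with `Γ = M⁻¹`, `M ≻ 0`),
the input's row-sum letter `κr`, its first-order kernel letters `lam, κd, H` (row∕column letters `κR, κC`), the precision letters and the
row-diagonal dominance `Σ_{w≠x}(|M_{xw}| + H_{xw}) ≤ γ(M_{xx} − lam)` (columns `≤ γ′`), and the second-moment letter:
`Σ_y |HessW(ψ)[e_x,e_y]| ≤ κr + κR·κC·(1−γ)⁻¹(1−γ′)⁻¹∕cmin` for every background `ψ` and site `x`. [folklore] -/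
theorem block_hessian_kernel_rowsum_le (hM : M.PosDef) (hΓop : (γop • (1 : Matrix ι ι ℝ) - M⁻¹).PosSemidef) (Y : Finset ι)
    (hUd : ∀ φ : EuclideanSpace ℝ ι, HasFDerivAt U (U' φ) φ) (hU'd : ∀ φ : EuclideanSpace ℝ ι, HasFDerivAt U' (U'' φ) φ)
    (hU''c : Continuous U'') (hκ₀ : 0 ≤ κ₀) (hκ₁ : 0 ≤ κ₁) (ha : 0 ≤ a) (hκ₂ : 0 ≤ κ₂) (hτ : 0 < τ) (hδ : 0 < δ) (hθ0 : 0 < θ) (hθ1 : θ < 1)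
    (hκθ : (2 * κ₀ * (1 + τ) + 4 * δ) * γop ≤ θ) (hstab : ∀ φ : EuclideanSpace ℝ ι, -(κ₀ * ∑ x ∈ Y, φ x ^ 2) ≤ U φ)
    (hU'b : ∀ φ : EuclideanSpace ℝ ι, ‖U' φ‖ ≤ κ₁ * (a + ∑ x ∈ Y, φ x ^ 2)) (hU''b : ∀ φ : EuclideanSpace ℝ ι, ‖U'' φ‖ ≤ κ₂)
    (hU''row : ∀ (φ : EuclideanSpace ℝ ι) (x : ι), ∑ y, |U'' φ (EuclideanSpace.single x (1 : ℝ)) (EuclideanSpace.single y (1 : ℝ))| ≤ κr)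
    (hUfloor : ∀ (x : ι) (φ : EuclideanSpace ℝ ι) (r : ℝ),
      -lam * r ^ 2 ≤ (U' (φ + r • EuclideanSpace.single x (1 : ℝ)) (EuclideanSpace.single x (1 : ℝ)) - U' φ (EuclideanSpace.single x (1 : ℝ))) * r)
    (hUceil : ∀ (x : ι) (φ : EuclideanSpace ℝ ι) (r : ℝ),
      |U' (φ + r • EuclideanSpace.single x (1 : ℝ)) (EuclideanSpace.single x (1 : ℝ)) - U' φ (EuclideanSpace.single x (1 : ℝ))| ≤ κd * |r|)
    (hUcross : ∀ (x w : ι) (φ : EuclideanSpace ℝ ι) (r : ℝ),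
      |U' (φ + r • EuclideanSpace.single w (1 : ℝ)) (EuclideanSpace.single x (1 : ℝ)) - U' φ (EuclideanSpace.single x (1 : ℝ))| ≤ H x w * |r|)
    (hH : ∀ x w, 0 ≤ H x w) (hκd : 0 ≤ κd) (hMdiag : ∀ x, |M x x| ≤ mM) (hcmin : 0 < cmin) (hcm : ∀ x, cmin ≤ M x x - lam)
    (hrow : ∀ x, ∑ w, (if w = x then 0 else |M x w| + H x w) / (M x x - lam) ≤ γ) (hγ0 : 0 ≤ γ) (hγ1 : γ < 1)
    (hcol : ∀ w, ∑ x, (if w = x then 0 else |M x w| + H x w) / (M x x - lam) ≤ γ') (hγ'1 : γ' < 1)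
    (hκR : ∀ x, ∑ w, (if w = x then κd else H x w) ≤ κR) (hκC : ∀ w, ∑ x, (if w = x then κd else H x w) ≤ κC)
    (hI0 : Integrable (fun ω : EuclideanSpace ℝ ι => exp (-U (ω + ψ))) (multivariateGaussian 0 M⁻¹))
    (hI2 : ∀ w, Integrable (fun ω : EuclideanSpace ℝ ι => exp (-U (ω + ψ)) * ω w ^ 2) (multivariateGaussian 0 M⁻¹)) (x : ι) :
    ∑ y, |((∫ ω : EuclideanSpace ℝ ι, exp (-U (ω + ψ)) ∂(multivariateGaussian 0 M⁻¹))⁻¹ • (∫ ω : EuclideanSpace ℝ ι, exp (-U (ω + ψ)) • (U'' (ω + ψ) - (U' (ω +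
        ψ)).smulRight (U' (ω + ψ))) ∂(multivariateGaussian 0 M⁻¹)) + (((∫ ω : EuclideanSpace ℝ ι, exp (-U (ω + ψ)) ∂(multivariateGaussian 0 M⁻¹)) ^ 2)⁻¹ • ∫ ω :
        EuclideanSpace ℝ ι, exp (-U (ω + ψ)) • U' (ω + ψ) ∂(multivariateGaussian 0 M⁻¹)).smulRight (∫ ω : EuclideanSpace ℝ ι, exp (-U (ω + ψ)) • U' (ω + ψ)
        ∂(multivariateGaussian 0 M⁻¹))) (EuclideanSpace.single x (1 : ℝ)) (EuclideanSpace.single y (1 : ℝ))| ≤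
      κr + κR * κC * (1 - γ)⁻¹ * (1 - γ')⁻¹ / cmin := by
  have h1 := hessian_kernel_rowsum_split hM.inv.posSemidef hΓop Y hUd hU'd hU''c hκ₀ hκ₁ ha hκ₂ hτ hδ hθ0 hθ1 hκθ hstab hU'b hU''b hU''row ψ x
  have h2 := gauss_cov_kernel_rowsum_le hM hUd hUfloor hUceil hUcross hH hκd hMdiag hcmin hcm hrow hγ0 hγ1 hcol hγ'1 hκR hκC hI0 hI2 x
  linarith

end Summit.QuantumFields.BalabanUV.T4Continuum.NE7b.SupBlockCovarianceKernelLetter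

end
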